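import Literature.AlgebraicGeometry.Resolution.NormalDegreePDefectlessVTGaloisProofs
import Mathlib.RingTheory.Valuation.LocalSubring
import HarnessLib

/-!
# Defectlessness passes to coarsenings; (R2) for a residue-transcendental generator from the value-transcendental case

Topic: `Literature/AlgebraicGeometry/Resolution` (valued function fields). PROVED valuation
theory towards the discharge of the named fact
`Kuhlmann2010SeparablyDefectlessRationalRT_sepClosed` (`Kuhlmann2019HenselianRationalityFiniteRank.lean`)
= F.-V. Kuhlmann, *Elimination of ramification I: The generalized stability theorem*, Trans.
AMS 362 (2010) = arXiv:1003.5678, Thm. 1.1, "separably defectless" clause, for `K(x)` with `x`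
RESIDUE-transcendental over a separably closed `K` (arbitrary rank). The dense-descent argument
of `SeparablyDefectlessRationalVTProofs.lean` needs, over the algebraically closed closure
`K' = K̃`, the "defectless" version of Thm. 1.1 for `K'(x)` — §5, (R2): "Every valued function
field of transcendence degree 1 without transcendence defect over an algebraically closed
field is a defectless field" — with a RESIDUE-transcendental generator, whereas the tree's
decomposition of Thm. 1.1 vendors and reduces (R2) only for a VALUE-transcendental generator
(`Kuhlmann2010StabilityAlgClosedValueTranscendental`, `GeneralizedStabilityTrdegOne.lean`;
Lemmas 5.3–5.4 proved for it). Instead of redoing Lemmas 5.3–5.4 (reduction to finite rank and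
to rank one) for residue-transcendental generators, we derive the residue-transcendental case
of (R2) from the value-transcendental one by a change of valuation:

* `IsDefectlessField.of_le` — **defectlessness passes to coarsenings** (the converse of
  Kuhlmann 2010, Lemma 2.17, `IsDefectlessField.of_le_of_residue`, `DefectlessComposite.lean`):
  if `(K, O)` is a defectless field and `O ≤ O₁`, then `(K, O₁)` is a defectless field. Proof:
  for `L|K` finite every extension `T` of `O` lies below a unique extension `W` of `O₁`
  (`comapHull`), and the extensions of `O` below a given `W` are lifts of extensions `T̄` of
  `O/𝔪_{O₁}` to `κ(W)` with `e(T) f(T) = e(W) e(T̄) f(T̄)`; by the fundamental inequality in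
  `κ(W) | κ(O₁)` they contribute at most `e(W) f(W)`, so `[L:K] = ∑ e(T) f(T) ≤ ∑ e(W) f(W)`.
* `exists_valuationSubring_le_residueSubfield_mem_nonunits` — for `x̄ ∈ κ(O)` transcendental
  over the subfield `Kv ⊆ κ(O)` there is a valuation ring `A` of `κ(O)` containing `Kv[x̄]` in
  which `x̄` is a non-unit (Chevalley; Mathlib's `Ideal.image_subset_nonunits_valuationSubring`).
* `isDefectlessField_of_residueTranscendental_of_algClosedVT` — **(R2) for `K(t)` with `t`
  residue-transcendental over the algebraically closed `K`, arbitrary rank, from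
  `Kuhlmann2010StabilityAlgClosedValueTranscendental`**: compose `O` with such an `A`
  (`residueOverringLift`, the `x̄`-adic refinement `O' ≤ O`); `O'` induces the same valuation
  ring on `K` and `t` is VALUE-transcendental for `O'`, so `(K(t), O')` is defectless by the
  value-transcendental case, hence so is its coarsening `(K(t), O)`.
* `isDefectlessField_of_residueTranscendental_of_rankOneRT` — the same from
  `Kuhlmann2010StabilityRankOneResidueTranscendental` alone
  (`Kuhlmann2010StabilityAlgClosedValueTranscendental.of_rankOne'`,
  `Kuhlmann2010StabilityRankOneValueTranscendental_holds`).

Everything is PROVED; no new definitions or named facts. The statements are [folklore]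
valuation theory (composite valuations: Kuhlmann 2010, §2.3, Lemma 2.17 and (8); Bourbaki,
*Alg. Comm.* VI §4, §8).

## Sources

* F.-V. Kuhlmann, Trans. AMS 362 (2010) = arXiv:1003.5678: §2.3 (Lemma 2.17), §5 (Lemma 5.2
  (R2), Lemmas 5.3–5.4). [Kuhlmann2010]
-/

noncomputable section

open IsLocalRing Polynomial

namespace Literature.AlgebraicGeometry.Resolution

universe u

/-! ### Defectlessness passes to coarsenings -/

section Coarsening

/-- **Defectlessness passes to coarsenings** (converse of Kuhlmann 2010, Lemma 2.17): if
`(K, O)` is a defectless field and `O ≤ O₁`, then `(K, O₁)` is a defectless field. For `L|K`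
finite, the extensions `T` of `O` to `L` below an extension `W` of `O₁` are the lifts of
extensions `T̄` of `O/𝔪_{O₁}` to `κ(W)`, with `e(T) = e(W) e(T̄)`, `f(T) = f(T̄)`; so they
contribute at most `e(W) [κ(W) : κ(O₁)] = e(W) f(W)` to `∑ e(T) f(T) = [L : K]`, and every `T`
lies below exactly one `W`. [folklore] -/
theorem IsDefectlessField.of_le {K : Type u} [Field K] (O O₁ : ValuationSubring K) (h : O ≤ O₁)
    (hO : IsDefectlessField K O) : IsDefectlessField K O₁ := by
  intro L _ _ hfin
  classical
  haveI := hfin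
  obtain ⟨s₁, hs₁, hle₁⟩ := FundamentalInequality_holds K L hfin O₁
  refine ⟨s₁, hs₁, le_antisymm hle₁ ?_⟩
  obtain ⟨s, hs, hsum⟩ := hO L hfin
  -- the extensions of `O` below `W ∈ s₁` contribute at most `e(W) f(W)`
  have hW : ∀ W ∈ s₁, ∑ T ∈ s.filter (· ≤ W), ramificationIndex K T * inertiaDegree K T ≤
      ramificationIndex K W * inertiaDegree K W := by
    intro W hW₁
    have hWc : W.comap (algebraMap K L) = O₁ := (hs₁ W).mp hW₁
    subst hWc
    letI : Algebra (W.comap (algebraMap K L)) W := comapAlgebra K W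
    haveI : IsLocalHom (algebraMap (W.comap (algebraMap K L)) W) :=
      isLocalHom_algebraMap_comap K W
    haveI := finiteDimensional_residueField K W
    obtain ⟨s₂, hs₂, hle₂⟩ := FundamentalInequality_holds (ResidueField (W.comap (algebraMap K L)))
      (ResidueField W) inferInstance (residueValuationSubring O (W.comap (algebraMap K L)) h)
    -- every `T ∈ s` below `W` is the lift of some `T̄ ∈ s₂`
    have hsub : s.filter (· ≤ W) ⊆ s₂.image (residueOverringLift W) := by
      intro T hT
      rw [Finset.mem_filter] at hT
      obtain ⟨hTs, hTW⟩ := hT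
      have hTc : T.comap (algebraMap K L) = O := (hs T).mp hTs
      subst hTc
      refine Finset.mem_image.mpr ⟨residueValuationSubring T W hTW, ?_, ?_⟩
      · rw [hs₂, residueValuationSubring_comap K T W hTW]
      · exact eq_of_residueValuationSubring_eq (residueOverringLift_le W _) hTW
          (residueValuationSubring_residueOverringLift W _)
    have hinj : ∀ S' ∈ s₂, ∀ S'' ∈ s₂,
        residueOverringLift W S' = residueOverringLift W S'' → S' = S'' := fun S' _ S'' _ hS => by
      rw [← residueValuationSubring_residueOverringLift W S',
        ← residueValuationSubring_residueOverringLift W S'']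
      simp only [hS]
    calc ∑ T ∈ s.filter (· ≤ W), ramificationIndex K T * inertiaDegree K T
        ≤ ∑ T ∈ s₂.image (residueOverringLift W), ramificationIndex K T * inertiaDegree K T :=
          Finset.sum_le_sum_of_subset hsub
      _ = ∑ S' ∈ s₂, ramificationIndex K (residueOverringLift W S') *
            inertiaDegree K (residueOverringLift W S') := Finset.sum_image hinj
      _ = ramificationIndex K W * ∑ S' ∈ s₂,
            ramificationIndex (ResidueField (W.comap (algebraMap K L))) S' *
              inertiaDegree (ResidueField (W.comap (algebraMap K L))) S' := by
          rw [Finset.mul_sum]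
          refine Finset.sum_congr rfl fun S' _ => ?_
          rw [ramificationIndex_eq_mul_residue K (residueOverringLift W S') W
              (residueOverringLift_le W S'),
            ← inertiaDegree_residueValuationSubring K (residueOverringLift W S') W
              (residueOverringLift_le W S'),
            residueValuationSubring_residueOverringLift]
          ring
      _ ≤ ramificationIndex K W * Module.finrank (ResidueField (W.comap (algebraMap K L)))
            (ResidueField W) := Nat.mul_le_mul_left _ hle₂
      _ = ramificationIndex K W * inertiaDegree K W := by rw [finrank_residueField K W]
  -- every `T ∈ s` lies below exactly one `W ∈ s₁`
  have hcover : s = s₁.biUnion fun W => s.filter (· ≤ W) := by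
    ext T
    simp only [Finset.mem_biUnion, Finset.mem_filter]
    constructor
    · intro hT
      have hTc : T.comap (algebraMap K L) = O := (hs T).mp hT
      have hW : (comapHull T (algebraMap K L) O₁).comap (algebraMap K L) = O₁ :=
        comap_comapHull T (algebraMap K L) O₁ (by rw [hTc]; exact h)
      exact ⟨comapHull T (algebraMap K L) O₁, (hs₁ _).mpr hW, hT, le_comapHull T _ O₁⟩
    · rintro ⟨W, -, hT, -⟩
      exact hT
  have hdisj : (↑s₁ : Set (ValuationSubring L)).PairwiseDisjoint fun W => s.filter (· ≤ W) := by
    intro W hW W' hW' hne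
    refine Finset.disjoint_left.mpr fun T hT hT' => hne ?_
    rw [Finset.mem_filter] at hT hT'
    exact eq_of_le_of_le_of_comap_eq K hT.2 hT'.2
      (((hs₁ W).mp hW).trans ((hs₁ W').mp hW').symm)
  calc Module.finrank K L = ∑ T ∈ s, ramificationIndex K T * inertiaDegree K T := hsum.symm
    _ = ∑ T ∈ s₁.biUnion (fun W => s.filter (· ≤ W)),
          ramificationIndex K T * inertiaDegree K T := by rw [← hcover]
    _ = ∑ W ∈ s₁, ∑ T ∈ s.filter (· ≤ W), ramificationIndex K T * inertiaDegree K T :=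
        Finset.sum_biUnion hdisj
    _ ≤ ∑ W ∈ s₁, ramificationIndex K W * inertiaDegree K W := Finset.sum_le_sum hW

end Coarsening

/-! ### A valuation of the residue field centred at a transcendental residue -/

section ResidueValuation

variable {F : Type u} [Field F]

/-- **Chevalley**: for a subfield `k ⊆ κ` and `x̄ ∈ κ` transcendental over `k`, there is a
valuation ring `A` of `κ` containing `k` and `x̄` in which `x̄` is a non-unit (a place of `κ`
centred at the prime `(x̄)` of `k[x̄] ≅ k[X]`; the ideal `(x̄)` is proper because `x̄` is
transcendental). [folklore] -/
theorem exists_valuationSubring_le_mem_nonunits {κ : Type u} [Field κ] (k : Subfield κ) {x : κ}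
    (hx : Transcendental k x) :
    ∃ A : ValuationSubring κ, (∀ c ∈ k, c ∈ A) ∧ x ∈ A ∧ x ∈ A.nonunits := by
  classical
  set R : Subring κ := (Algebra.adjoin k ({x} : Set κ)).toSubring with hR
  have hxR : x ∈ R := Algebra.subset_adjoin (Set.mem_singleton x)
  have hkR : ∀ c ∈ k, c ∈ R := fun c hc => (Algebra.adjoin k ({x} : Set κ)).algebraMap_mem ⟨c, hc⟩
  set I : Ideal R := Ideal.span {⟨x, hxR⟩} with hI
  have hI : I ≠ ⊤ := by
    intro htop
    have h1 : (1 : R) ∈ I := htop ▸ Submodule.mem_top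
    rw [hI, Ideal.mem_span_singleton'] at h1
    obtain ⟨r, hr⟩ := h1
    -- `r = g(x)` for a polynomial `g` over `k`
    have hrA : (r : κ) ∈ Algebra.adjoin k ({x} : Set κ) := r.2
    rw [Algebra.adjoin_singleton_eq_range_aeval] at hrA
    obtain ⟨g, hg⟩ := hrA
    apply hx
    refine ⟨g * X - 1, ?_, ?_⟩
    · intro h0
      have := congrArg (fun p : Polynomial k => p.eval 0) h0
      simp at this
    · have hr' : (r : κ) * x = 1 := by
        have := congrArg (Subtype.val : R → κ) hr
        simpa using this
      change aeval x (g * X - 1) = 0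
      rw [map_sub, map_mul, aeval_X, map_one]
      change (aeval x g : κ) * x - 1 = 0
      rw [show (aeval x g : κ) = (r : κ) from hg, hr', sub_self]
  obtain ⟨A, hRA, hIA⟩ := Ideal.image_subset_nonunits_valuationSubring I hI
  refine ⟨A, fun c hc => hRA (hkR c hc), hRA hxR, ?_⟩
  exact hIA ⟨⟨x, hxR⟩, Ideal.subset_span (Set.mem_singleton _), rfl⟩

end ResidueValuation

/-! ### (R2) for a residue-transcendental generator from the value-transcendental case -/

section RTfromVT

/-- **(R2) for `F = K(t)` with `t` residue-transcendental over the algebraically closed `K`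
(arbitrary rank), from the value-transcendental case.** Let `A` be a valuation ring of the
residue field `κ(O) = Kv(t̄)` over `Kv` in which `t̄` is a non-unit
(`exists_valuationSubring_le_mem_nonunits`) and `O' = {a ∈ O : ā ∈ A} ≤ O` the composite
valuation ring (`residueOverringLift`). Then `O' ∩ K = O ∩ K` and `t` is value-transcendental
for `O'` (if `v'(t)^n = v'(c)`, then `v(c) = 1` and `t̄^n/c̄` would be a unit of `A`), so
`(F, O')` is defectless by `Kuhlmann2010StabilityAlgClosedValueTranscendental`, and so is its
coarsening `(F, O)` (`IsDefectlessField.of_le`). [cite: Kuhlmann2010, Section 5, Lemma 5.2 (R2)] -/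
theorem isDefectlessField_of_residueTranscendental_of_algClosedVT
    (hB : Kuhlmann2010StabilityAlgClosedValueTranscendental.{u})
    (K F : Type u) [Field K] [Field F] [Algebra K F] [IsAlgClosed K] (O : ValuationSubring F)
    (t : O) (htr : Transcendental (residueSubfield K O) (residue O t))
    (hgen : IntermediateField.adjoin K ({(t : F)} : Set F) = ⊤) : IsDefectlessField F O := by
  classical
  -- the valuation ring `A` of the residue field and the composite `O' ≤ O`
  obtain ⟨A, hKA, htA, htnu⟩ := exists_valuationSubring_le_mem_nonunits (residueSubfield K O) htr
  set O' : ValuationSubring F := residueOverringLift O A with hO'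
  have hO'le : O' ≤ O := residueOverringLift_le O A
  -- `t` is a unit of `O`: its residue is non-zero
  have hres0 : residue O t ≠ 0 := fun h0 => hx0 htr h0
  have htunit : IsUnit t := by
    by_contra hnu
    exact hres0 ((residue_eq_zero_iff t).mpr ((mem_maximalIdeal _).mpr hnu))
  have hvt : O.valuation (t : F) = 1 := (O.valuation_eq_one_iff t).mp htunit
  have ht0 : (t : F) ≠ 0 := fun h => by rw [h, map_zero] at hvt; exact zero_ne_one hvt
  -- `t` is value-transcendental for `O'`
  have hvt' : ∀ n : ℕ, 0 < n → ∀ c : K,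
      O'.valuation (t : F) ^ n ≠ O'.valuation (algebraMap K F c) := by
    intro n hn c h
    have hc0 : algebraMap K F c ≠ 0 := by
      intro hc
      rw [hc, map_zero, pow_eq_zero_iff hn.ne', Valuation.zero_iff] at h
      exact ht0 h
    -- `u = t^n / c` is a unit of `O'`
    set u : F := (t : F) ^ n / algebraMap K F c with hu
    have hvu : O'.valuation u = 1 := by
      rw [hu, map_div₀, map_pow, h, div_self]
      exact (Valuation.ne_zero_iff _).mpr hc0
    have huO' : u ∈ O' := (O'.valuation_le_one_iff u).mp hvu.le
    have huiO' : u⁻¹ ∈ O' := (O'.valuation_le_one_iff _).mp (by rw [map_inv₀, hvu, inv_one])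
    obtain ⟨huO, huA⟩ := (mem_residueOverringLift_iff O A u).mp huO'
    obtain ⟨huiO, huiA⟩ := (mem_residueOverringLift_iff O A u⁻¹).mp huiO'
    have hu0 : u ≠ 0 := div_ne_zero (pow_ne_zero _ ht0) hc0
    -- `c ∈ O` with non-zero residue in `Kv`
    have hvOu : O.valuation u = 1 := by
      refine le_antisymm ((O.valuation_le_one_iff u).mpr huO) ?_
      have := (O.valuation_le_one_iff _).mpr huiO
      rwa [map_inv₀, inv_le_one₀ ((Valuation.pos_iff _).mpr hu0)] at this
    have hvc : O.valuation (algebraMap K F c) = 1 := by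
      have h1 : O.valuation ((t : F) ^ n) = O.valuation u * O.valuation (algebraMap K F c) := by
        rw [← map_mul, hu, div_mul_cancel₀ _ hc0]
      rw [map_pow, hvt, one_pow, hvOu, one_mul] at h1
      exact h1.symm
    have hcO : algebraMap K F c ∈ O := (O.valuation_le_one_iff _).mp hvc.le
    have hcres : residue O ⟨algebraMap K F c, hcO⟩ ∈ residueSubfield K O :=
      residue_mem_residueSubfield K O c hcO
    have hcres0 : residue O ⟨algebraMap K F c, hcO⟩ ≠ 0 := by
      intro h0
      rw [residue_eq_zero_iff, mem_maximalIdeal, mem_nonunits_iff] at h0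
      exact h0 ((O.valuation_eq_one_iff _).mpr hvc)
    -- values in `A`: `Ā(c̄) = 1`, `Ā(ū) = 1`, `Ā(t̄) < 1`
    have hAc : A.valuation (residue O ⟨algebraMap K F c, hcO⟩) = 1 := by
      refine le_antisymm ((A.valuation_le_one_iff _).mpr (hKA _ hcres)) ?_
      have := (A.valuation_le_one_iff _).mpr (hKA _ ((residueSubfield K O).inv_mem hcres))
      rwa [map_inv₀, inv_le_one₀ ((Valuation.pos_iff _).mpr hcres0)] at this
    have hures0 : residue O ⟨u, huO⟩ ≠ 0 := by
      intro h0
      rw [residue_eq_zero_iff, mem_maximalIdeal, mem_nonunits_iff] at h0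
      exact h0 ((O.valuation_eq_one_iff _).mpr hvOu)
    have hAu : A.valuation (residue O ⟨u, huO⟩) = 1 := by
      refine le_antisymm ((A.valuation_le_one_iff _).mpr huA) ?_
      have hinv : residue O ⟨u⁻¹, huiO⟩ = (residue O ⟨u, huO⟩)⁻¹ := residue_mk_inv O huO huiO hu0
      have := (A.valuation_le_one_iff _).mpr huiA
      rwa [hinv, map_inv₀, inv_le_one₀ ((Valuation.pos_iff _).mpr hures0)] at this
    have hAt : A.valuation (residue O t) < 1 := (A.mem_nonunits_iff).mp htnu
    -- `t̄^n = ū c̄`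
    have hprod : residue O t ^ n = residue O ⟨u, huO⟩ * residue O ⟨algebraMap K F c, hcO⟩ := by
      rw [← map_pow, ← map_mul]
      congr 1
      apply Subtype.ext
      change (t : F) ^ n = u * algebraMap K F c
      rw [hu, div_mul_cancel₀ _ hc0]
    have h1 : A.valuation (residue O t) ^ n = 1 := by
      rw [← map_pow, hprod, map_mul, hAu, hAc, one_mul]
    have h2 : A.valuation (residue O t) ^ n < 1 := pow_lt_one' hAt hn.ne'
    rw [h1] at h2
    exact lt_irrefl _ h2
  -- `(F, O')` is defectless by the value-transcendental case, hence so is `(F, O)`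
  exact IsDefectlessField.of_le O' O hO'le (hB K F O' (t : F) hvt' hgen)
  where
    /-- a transcendental element is non-zero -/
    hx0 {k : Subfield (ResidueField O)} {r : ResidueField O} (h : Transcendental k r) :
        r = 0 → False := fun h0 => h (h0 ▸ isAlgebraic_zero)

/-- **(R2) for a residue-transcendental generator over an algebraically closed field, from the
rank-one residue-transcendental case of (R4) alone**
(`Kuhlmann2010StabilityAlgClosedValueTranscendental.of_rankOne'` with
`Kuhlmann2010StabilityRankOneValueTranscendental_holds`).
[cite: Kuhlmann2010, Section 5, Lemma 5.2 (R2) and Lemmas 5.3–5.4] -/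
theorem isDefectlessField_of_residueTranscendental_of_rankOneRT
    (h4r : Kuhlmann2010StabilityRankOneResidueTranscendental.{u})
    (K F : Type u) [Field K] [Field F] [Algebra K F] [IsAlgClosed K] (O : ValuationSubring F)
    (t : O) (htr : Transcendental (residueSubfield K O) (residue O t))
    (hgen : IntermediateField.adjoin K ({(t : F)} : Set F) = ⊤) : IsDefectlessField F O :=
  isDefectlessField_of_residueTranscendental_of_algClosedVT
    (Kuhlmann2010StabilityAlgClosedValueTranscendental.of_rankOne'
      Kuhlmann2010StabilityRankOneValueTranscendental_holds h4r) K F O t htr hgen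

end RTfromVT

end Literature.AlgebraicGeometry.Resolution

end
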